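import Literature.MathematicalPhysics.QuantumFieldTheory.Balaban1983to89.Node00.HistoryTermIndexedGenerator
import Literature.MathematicalPhysics.QuantumFieldTheory.Balaban1983to89.B13Lemma3TorusPrimitive
import Literature.MathematicalPhysics.QuantumFieldTheory.Balaban1983to89.B13TermWalkDataOneTorus

/-!
# NODE 00 (YM-PLAN Track A) — W1 = [II] §2 (2.13)–(2.14), STOREY 7: THE (2.14) TERM DATUM ON THE RECORD'S TORUS CATALOGUE AND THE
# TERM FUNCTIONAL IT GENERATES (`W1.TermDatum214`, `W1.TermDatum214.TF`, `W1.TermData214.Gn`; the history enters through `𝐕_k` only;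
# the (2.26) socket of `B13Lemma3TorusPrimitive.h226_torus_of_primitives` at the datum, kernel-keyed)

NODE 00 DEFINER MODULE (seat `pub-ymgap-node00-def-W1`, generation 7, 2026-08-27).  APPEND-ONLY: a NEW importing module; g6's
`Node00/HistoryTermIndexedGenerator` (`TermLabel`, `TermFun`, `GenTermFun`, `StepGen.ofTerms`, `GenTower.ofTerms`), `B13Term214` (`term214`,
`core214`, `F214`), `B13TermWalkData[OneTorus]` (`TermKernels`, `freeKernels`) and `B13Lemma3TorusPrimitive` (`h226_torus_of_primitives`) untouched and CONSUMED BY NAME.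
[II] = [Balaban1988RG2Cluster] T. Bałaban, *Renormalization group approach to lattice gauge field theories. II. Cluster expansions*, Commun.
Math. Phys. **116** (1988) 1–22; [I] = [Balaban1987RG1], part I, Commun. Math. Phys. **109** (1987) 249–301.

THE PIN.  g6 typed the generator of record as `GenTower.ofTerms L TF` for a FREE term functional `TF k Z t s old φ` — the value of the (2.14)
term of `Z ∈ 𝐃_{k+1}` labelled `t = (𝐃, P)` as a function of the last coupling `s = g_k`, the older terms `old = (E^{(j)})_{j ≤ k}` and the
configuration `φ`; the Summit-side consumers of nodes N18 (`…N18HLayerW1TermIndexed`, (T-an)∕(T-226) per term) and N22 (`…N22W1StripTermIndexed`,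
(S-loc-T)∕(S-226-T)∕(S-last-T) per term) hold `TF` as a parameter.  THIS STOREY TYPES THE FORMULA (2.14) ITSELF IN W1's CURRENCY: a
**term datum** `𝔇 : TermDatum214 c P 𝔸 M k L` = the located objects print's display (2.14) p. 15 is assembled from, per term `t = (𝐃, P)` of
every `Z ∈ 𝐃_{k+1}` of the record's torus catalogue (`Sect2.domSys P M (k+1)`, fine torus `L · domCount P M (k+1)` cubes per direction):
* [13]'s site torus `UT Nf` and the kernels' configuration space `E₃`; NODE A's KERNEL RECORD `𝒦 Z t : B13TermWalkData.TermKernels c P.d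
  (domCount P M (k+1)) ν Nf E₃` (the operators `A(σ,u) = C^{(k)}(Z₀,σ(Z))⁻¹`, `G(σ,u)` of `Γ_k(Z₀,σ(Z))` on the row bonds, real references,
  locations — [II] p. 13, p. 15; [Balaban1985BackgroundPropagators] Thm 3.10); the configuration reading `uOf Z t φ : E₃` (p. 15: `U = U′U`);
  the Cauchy radius `r` of (2.14)'s contours;
* the characteristic functions `χ_{k,Y₀}(B)`, `χᶜ_{k,P}(B)` of the decomposition (2.3) AT THE COUPLING `s` (abstract real functions of the row-bond
  fluctuation field; their thresholds are functions of the running coupling, [I] (2.9), (2.12) — no threshold law is typed here);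
* **the potentials `𝐕_k(Y, ·)` of (1.41) AS A FUNCTION OF THE HISTORY**: `𝒱 Z t s old φ Y B` — the value of `𝐕_k(Y, 𝐔_{k+1}, B)` at coupling `s`,
  OLDER TERMS `old`, configuration `φ` and row-bond fluctuation field `B` ([II] Lemma 2 p. 11: the older terms `E^{(j)}`, `j ≤ k`, enter the
  step through, and ONLY through, these potentials; [I] (2.12)–(2.13) p. 268).  DATA — Lemma 2's construction ((1.33)–(1.41)) is NOT typed here.
Then, DEFINITIONALLY (print's display, `B13Term214` by name):
  `𝔇.TF Z t s old φ := term214 r (Z∖Z′₀) 𝐃 (core214 (σ ↦ A(σ, uOf φ)) (σ X ↦ G(σ, uOf φ)·X) (F214 |P| χ_{k,Y₀}(s,·) χᶜ_{k,P}(s,·) 𝐃 (𝒱 s old φ))) 0 0`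
— A `W1.TermFun P 𝔸 M k L`; for a family `𝔇 : TermData214 c P 𝔸 M L` (one datum per step) `𝔇.TF : GenTermFun P 𝔸 M L` and **`𝔇.Gn := GenTower.ofTerms L
𝔇.TF`** — the generator tower OF A TERM-DATUM FAMILY, at which the N18∕N22 term-indexed modules instantiate verbatim (`TF := 𝔇.TF`).
WHAT IT GIVES BY NAME:
* `TF_apply` (the display, `rfl`); `sigmaList`∕`tauList` + `sigmaList_spec`∕`tauList_spec` (the σ∕τ parameter lists of (2.14) = the cubes of `Z∖Z′₀` and
  the domains of 𝐃, `Nodup ∧ toFinset = …` — the `hlZ`∕`hlD` binders of the (2.26) engines); `Gam_eq` (Γ(σ)X = G(σ,u)·X — the `hlin` binder, `rfl`);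
  `H_Gn` (the activity (2.11) of `𝔇.Gn` = Σ_{t ∈ terms} (2.14)), `norm_H_Gn_le`, `recTerm_Gn_succ` (THE W1 RECURSION (2.13) WITH THE (2.14) TERMS OF THE DATUM);
* **HISTORY ENTERS THROUGH 𝐕_k ONLY**: `TF_congr_old` — older terms giving the same potentials give the same term (the atom of N22's per-term locality
  (S-loc-T): a locality law of `𝒱` alone transfers to `TF`); `TF_congr` (joint congruence in coupling ∕ history ∕ configuration through
  `χ(s,·)`, `uOf φ`, `𝒱 s old φ`); `lastLine_congr_old`, `core_congr_old`; the hypothesis schema `PotentialsLocalOn sp` (locality of 𝐕_k in the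
  history on a space-table family — a LAW, not asserted) and `TF_congr_old_of_potentialsLocalOn` = N22's per-term `hlocT` shape at `TF := 𝔇.TF`;
* **THE (2.26) SOCKET AT THE DATUM, KERNEL-KEYED**: `norm_TF_le_weight_of_primitives` — `B13Lemma3TorusPrimitive.h226_torus_of_primitives` for the term
  `𝔇.TF Z t s old φ` with the Γ-kernel `G(σ) := (𝒦 Z t).G2 σ (uOf φ)`, the references `Γ₀ := (𝒦 Z t).Γ₀`, `C := (𝒦 Z t).C ≻ 0` (`(𝒦 Z t).hC`), the
  locations `(𝒦 Z t).locΛ∕locN` and the fibre bound `(𝒦 Z t).hfib` READ OFF NODE A's kernel record, and `hlZ`, `hlD`, `hlin` DISCHARGED (`sigmaList_spec`,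
  `tauList_spec`, `rfl`): **`‖𝔇.TF Z t s old φ‖ ≤ weight L M c Z a t · exp(a₅|Z|)`** — the `h226` hypothesis shape of `B13Lemma3TorusTerms.hrep_of_termwise` and
  of the Summit-side per-term schemas — from the LOCATED inputs only: (L17a)∕(L16a) bounds of the kernels at the configuration (NODE A:
  `B13TermWalkData.localisation17a_of_termWalkData` ∕ `differences216_of_termWalkData` from `TermWalkData (𝒦 Z t) w`), separate analyticity of the
  X-integral, symmetry ∕ `Re ≻ 0` of `A(σ,u)`, the (2.22) shape of `χχᶜ` and the (2.20) shape of `𝒱` (Lemma 2), the column fibre bound, and the numerics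
  of (2.24)–(2.26).  No estimate is proved here: one application of the tree theorem at the datum's pins;
* NON-VACUITY: `nonempty_termDatum214` ∕ `nonempty_termData214` — term data exist (free kernels on one row bond, zero readings; degenerate data).
HONESTY: the datum pins the FORMULA and the dependence structure «kernels ← configuration; χ ← coupling; 𝐕_k ← (coupling, history, configuration)»,
NOTHING analytic; `TF_congr_old` shows the whole history-dependence of a (2.14) term sits in `𝒱` — so every history-Lipschitz ∕ locality ∕ analyticity
property of the generated tower is a property of Lemma 2's potentials and NODE A's kernels, displayed downstream, not manufactured here.

RELATION TO `Node00/CarriersB13KernelTower` (node00-def-B13 g4, `ResidB13K.T₃`): the SAME display `term214 r lZ lD (core214 A Γ (F214 …)) 0 0` over the same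
generic `B13Term214` objects, there keyed on the [B13] Stage-3 record (`TDom 4 (n+1)`, `B13TermIdx θ n m₃`, a configuration TYPE `Φ` carrying `B`, the
coupling `g` and the potential `V` as FIELDS of the layer); here keyed on W1's catalogue (`domSys P M (k+1)`, `TermLabel P M k L`, `CPair P 𝔸`) with the
coupling and the older terms as ARGUMENTS — the currency of `W1.TermFun` in which the recursion (2.13) `recTerm` runs.  Nothing of that module is restated:
its pins `rP`, `Y0l`, `Pl`, `emb`, `frame.V` are one level below this datum's primitive fields `chiY₀`, `chicP`, `𝒱`.

HONEST FRAMING: definitions + kernel bookkeeping (`rfl`, `Finset` list facts, congruences, one application of a tree theorem); NO estimate; nothing of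
Bałaban's asserted or constructed; the term datum is DATA (no law); N18 ∕ N22 ∕ N10 NOT discharged; K3‴ untouched; counts unmoved; one finite 𝕋⁴
programme at fixed ε, Bałaban as printed — NOT continuum ∕ ℝ⁴ ∕ infinite volume ∕ OS ∕ mass gap ∕ Clay.  No `sorry`, no `axiom`, no new `instance`
declarations (the structure's instance-implicit fields are registered as in `B13TermWalkData.TermKernels`), no `notation`.

References (TYPES and page anchors only): [II] (1.41) p.11, p.13, (2.3) p.12, (2.9)–(2.14) pp.14–15, (2.16)–(2.22) p.16, (2.23)–(2.26) p.17;
[I] (2.9) p.266, (2.12)–(2.13) p.268; [Balaban1985BackgroundPropagators] Thm 3.10 p.416.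
-/

open scoped BigOperators

noncomputable section

namespace Literature.MathematicalPhysics.QuantumFieldTheory.Balaban1983to89.Node00

open Metric Set Matrix
open Literature.MathematicalPhysics.QuantumFieldTheory.Balaban1983to89
open Step B14.Eq213MaximalDomains TreeLengthTorus T4Continuum Sect2
open Literature.MathematicalPhysics.QuantumFieldTheory.Balaban1983to89.TreeLengthTorusGeometry (tgeometry)
open Literature.MathematicalPhysics.QuantumFieldTheory.Balaban1983to89.TreeLengthTorusTransfer (tclosure)
open Literature.MathematicalPhysics.QuantumFieldTheory.Balaban1983to89.B13Lemma3TorusData (TBond)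
open Literature.MathematicalPhysics.QuantumFieldTheory.Balaban1983to89.B13Lemma3TorusTerms (terms weight Z0)
open Literature.MathematicalPhysics.QuantumFieldTheory.Balaban1983to89.B13Term214 (term214 SepHolOn core214 F214)
open Literature.MathematicalPhysics.QuantumFieldTheory.Balaban1983to89.B13TermWalkData (TermKernels)
open Literature.MathematicalPhysics.QuantumFieldTheory.Balaban1983to89.B13TermWalkDataOneTorus (freeKernels)
open Literature.MathematicalPhysics.QuantumFieldTheory.Balaban1983to89.B13Bound143 (invTau)
open Literature.MathematicalPhysics.QuantumFieldTheory.Balaban1983to89.B9Thm37GlueTorus (tdist1)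
open Literature.MathematicalPhysics.QuantumFieldTheory.Balaban1983to89.B5TorusCover (UT)
open Literature.MathematicalPhysics.QuantumFieldTheory.Balaban1983to89.B13Lemma3TorusPrimitive (h226_torus_of_primitives)

namespace W1

/-! ## §1  The (2.14) term datum at step `k` and the term functional it generates -/

section Datum

variable (c : B13.Consts) (P : Params) (𝔸 : Type*) (M k L : ℕ) [NeZero L]

/-- **THE (2.14) TERM DATUM AT STEP `k` ON THE RECORD'S TORUS CATALOGUE** (DATA, no law): for every `Z ∈ 𝐃_{k+1}` and every term label
`t = (𝐃, P)` — [13]'s site torus and the kernels' configuration space, NODE A's kernel record `𝒦 Z t` (print's `C^{(k)}(Z₀,σ(Z))⁻¹`, `Γ_k(Z₀,σ(Z))`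
as σ- and configuration-dependent matrices on the row bonds, with real references and locations), the configuration reading `uOf`, the Cauchy
radius `r`, the characteristic functions of (2.3) at the coupling, and the potentials `𝐕_k(Y, ·)` of (1.41) as a function of (coupling, OLDER TERMS,
configuration, row-bond fluctuation field).  The (2.14) term is DEFINED from these (`TermDatum214.TF`).
[cite: Balaban1988RG2Cluster, (2.14) p.15, (2.3) p.12, (1.41) p.11, p.13; Balaban1987RG1, (2.12)-(2.13) p.268; Balaban1985BackgroundPropagators, Thm 3.10 p.416] -/
structure TermDatum214 where
  /-- [13]: the dimension index of the site torus of the walks -/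
  ν : ℕ
  /-- [13]: the periods of the site torus `UT Nf` -/
  Nf : Fin ν → ℕ
  [neNf : ∀ i, NeZero (Nf i)]
  /-- the configuration argument space of the kernels (p. 15: (𝐔, 𝐉) with U = U′U, small A′, J) -/
  E₃ : Type
  [normedE₃ : NormedAddCommGroup E₃]
  [spaceE₃ : NormedSpace ℂ E₃]
  /-- (2.14) p. 15 ∕ p. 13: NODE A's kernel data of the term `t = (𝐃, P)` of `Z` — `A(σ,u) = C^{(k)}(Z₀,σ(Z))⁻¹`, `G(σ,u)` of `Γ_k(Z₀,σ(Z))`,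
  references, locations -/
  𝒦 : (domSys P M (k + 1)).Dom → TermLabel P M k L → TermKernels c P.d (domCount P M (k + 1)) ν Nf E₃
  [finC₀ : ∀ Z t, Fintype (𝒦 Z t).C₀]
  [decC₀ : ∀ Z t, DecidableEq (𝒦 Z t).C₀]
  /-- p. 15: the configuration `u` the kernels read at `φ = (𝐔, 𝐉)` -/
  uOf : (domSys P M (k + 1)).Dom → TermLabel P M k L → CPair P 𝔸 → E₃
  /-- (2.14): the radius of the Cauchy contours `|σ(Δ) − s(Δ)| = r`, `|τ(Y) − t(Y)| = r` -/
  r : ℝ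
  /-- (2.3): `χ_{k,Y₀}(B)` at the coupling (small-field characteristic function of the row-bond fluctuation field) -/
  chiY₀ : (Z : (domSys P M (k + 1)).Dom) → (t : TermLabel P M k L) → ℂ → ((𝒦 Z t).Λ → ℝ) → ℝ
  /-- (2.3): `χᶜ_{k,P}(B)` at the coupling (large-field characteristic function on the bonds of P) -/
  chicP : (Z : (domSys P M (k + 1)).Dom) → (t : TermLabel P M k L) → ℂ → ((𝒦 Z t).Λ → ℝ) → ℝ
  /-- (1.41): `𝐕_k(Y, 𝐔_{k+1}, B)` at (coupling, OLDER TERMS, configuration, row-bond fluctuation field) — Lemma 2's potentials as a function of the history -/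
  𝒱 : (Z : (domSys P M (k + 1)).Dom) → (t : TermLabel P M k L) → ℂ → OlderTerms P 𝔸 M k → CPair P 𝔸 →
    TDom P.d (L * domCount P M (k + 1)) → ((𝒦 Z t).Λ → ℝ) → ℂ

attribute [instance] TermDatum214.neNf TermDatum214.normedE₃ TermDatum214.spaceE₃ TermDatum214.finC₀ TermDatum214.decC₀

/-- **A TERM-DATUM FAMILY**: one (2.14) term datum per step `k = 0, 1, 2, …`. [cite: Balaban1987RG1, (2.12)-(2.13) p.268 (every step); Balaban1988RG2Cluster, (2.14) p.15] -/
abbrev TermData214 := (k : ℕ) → TermDatum214 c P 𝔸 M k L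

variable {c P M k}

open Classical in
/-- **The σ-parameter list of (2.14): the cubes `Δ ⊂ Z ∖ Z′₀`** (Z′₀ = the closure in 𝐃_{k+1} of the term's Z₀: `tclosure` of
`B13Lemma3TorusTerms.Z0`), as a list. [cite: Balaban1988RG2Cluster, (2.14) p.15 (Π_{Δ⊂Z∖Z′₀}) and p.13 (Z′₀)] -/
def sigmaList (Z : (domSys P M (k + 1)).Dom) (t : TermLabel P M k L) : List (TPt P.d (domCount P M (k + 1))) :=
  ((Z : TDom P.d (domCount P M (k + 1))).1 \ tclosure L (domCount P M (k + 1)) (Z0 M t)).toList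

variable (P M k) in
/-- **The τ-parameter list of (2.14): the domains `Y ∈ 𝐃`**, as a list. [cite: Balaban1988RG2Cluster, (2.14) p.15 (Π_{Y∈𝐃})] -/
def tauList (t : TermLabel P M k L) : List (TDom P.d (L * domCount P M (k + 1))) := t.1.toList

end Datum

namespace TermDatum214

variable {c : B13.Consts} {P : Params} {𝔸 : Type*} {M k L : ℕ} [NeZero L] (𝔇 : TermDatum214 c P 𝔸 M k L)

/-- **`A(σ) := C^{(k)}(Z₀,σ(Z))⁻¹` at the configuration**: the kernel record's precision at `u = uOf Z t φ`. [cite: Balaban1988RG2Cluster, (2.14) p.15] -/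
def A (Z : (domSys P M (k + 1)).Dom) (t : TermLabel P M k L) (φ : CPair P 𝔸) (σ : TPt P.d (domCount P M (k + 1)) → ℂ) :
    Matrix (𝔇.𝒦 Z t).Λ (𝔇.𝒦 Z t).Λ ℂ :=
  (𝔇.𝒦 Z t).A2 σ (𝔇.uOf Z t φ)

/-- **`Γ_k(Z₀,σ(Z))X := G(σ,u)·X`** at the configuration `u = uOf Z t φ` (p. 15 after (2.14); the `hlin` binder's right-hand side).
[cite: Balaban1988RG2Cluster, (2.14) p.15 (Γ_k(Z₀,σ(Z)) = C*Δ_k(σ(Z))CZ₀ᶜ(C^{(k)})^{1/2}(σ(Z)))] -/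
def Gam (Z : (domSys P M (k + 1)).Dom) (t : TermLabel P M k L) (φ : CPair P 𝔸) (σ : TPt P.d (domCount P M (k + 1)) → ℂ)
    (X : (𝔇.𝒦 Z t).Λ ⊕ (𝔇.𝒦 Z t).C₀ → ℝ) : (𝔇.𝒦 Z t).Λ → ℂ :=
  (𝔇.𝒦 Z t).G2 σ (𝔇.uOf Z t φ) *ᵥ fun j => (X j : ℂ)

/-- **The last line of (2.14) at (coupling, history, configuration)**: `(−1)^{|P|} χ_{k,Y₀}(s,B) χᶜ_{k,P}(s,B) exp[Σ_{Y∈𝐃} τ(Y)𝐕_k(Y, B)]` with the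
potentials READ FROM THE HISTORY (`B13Term214.F214` by name). [cite: Balaban1988RG2Cluster, (2.14) p.15 and (1.41) p.11] -/
def lastLine (Z : (domSys P M (k + 1)).Dom) (t : TermLabel P M k L) (s : ℂ) (old : OlderTerms P 𝔸 M k) (φ : CPair P 𝔸) :
    (TDom P.d (L * domCount P M (k + 1)) → ℂ) → ((𝔇.𝒦 Z t).Λ → ℝ) → ℂ :=
  F214 t.2.card (𝔇.chiY₀ Z t s) (𝔇.chicP Z t s) t.1 (𝔇.𝒱 Z t s old φ)

/-- **The X-integral Ψ(σ, τ) of (2.14)** (lines 2–4) for the term's kernels at the configuration and its last line at (coupling, history)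
(`B13Term214.core214` by name). [cite: Balaban1988RG2Cluster, (2.14) p.15] -/
def core (Z : (domSys P M (k + 1)).Dom) (t : TermLabel P M k L) (s : ℂ) (old : OlderTerms P 𝔸 M k) (φ : CPair P 𝔸) :
    (TPt P.d (domCount P M (k + 1)) → ℂ) → (TDom P.d (L * domCount P M (k + 1)) → ℂ) → ℂ :=
  core214 (𝔇.A Z t φ) (𝔇.Gam Z t φ) (𝔇.lastLine Z t s old φ)

open Classical in
/-- **THE TERM FUNCTIONAL GENERATED BY THE DATUM** — print's (2.14): `T_{(𝐃,P)}(Z)(g_k, (E^{(j)})_{j≤k}, φ) := term214 r (Z∖Z′₀) 𝐃 Ψ 0 0`, the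
Cauchy operators in `σ(Δ)`, `τ(Y)` applied to the X-integral, base points `σ = 0` off `Z∖Z′₀` ((2.8)) and `τ = 0` ((2.1)); a `W1.TermFun`: the
coupling and the OLDER TERMS are arguments. [cite: Balaban1988RG2Cluster, (2.14) p.15, (2.8) p.14, (2.1) p.12; Balaban1987RG1, (2.12)-(2.13) p.268] -/
def TF : TermFun P 𝔸 M k L := fun Z t s old φ =>
  term214 𝔇.r (sigmaList L Z t) (tauList P M k L t) (𝔇.core Z t s old φ) 0 0

/-! ### Faces (`rfl` ∕ list bookkeeping) -/

open Classical in
/-- The display (2.14) of the generated term functional (`rfl`). [cite: Balaban1988RG2Cluster, (2.14) p.15] -/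
theorem TF_apply (Z : (domSys P M (k + 1)).Dom) (t : TermLabel P M k L) (s : ℂ) (old : OlderTerms P 𝔸 M k) (φ : CPair P 𝔸) :
    𝔇.TF Z t s old φ =
      term214 𝔇.r (sigmaList L Z t) (tauList P M k L t)
        (core214 (𝔇.A Z t φ) (𝔇.Gam Z t φ) (F214 t.2.card (𝔇.chiY₀ Z t s) (𝔇.chicP Z t s) t.1 (𝔇.𝒱 Z t s old φ))) 0 0 := rfl

/-- Face: `A(σ) = (𝒦 Z t).A2 σ (uOf Z t φ)` (`rfl`). [cite: Balaban1988RG2Cluster, (2.14) p.15 (bookkeeping)] -/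
@[simp] theorem A_apply (Z : (domSys P M (k + 1)).Dom) (t : TermLabel P M k L) (φ : CPair P 𝔸) (σ : TPt P.d (domCount P M (k + 1)) → ℂ) :
    𝔇.A Z t φ σ = (𝔇.𝒦 Z t).A2 σ (𝔇.uOf Z t φ) := rfl

/-- Face (the `hlin` binder of the (2.26) engines): `Γ(σ)X = G(σ,u)·X` with `G(σ) = (𝒦 Z t).G2 σ (uOf Z t φ)` (`rfl`).
[cite: Balaban1988RG2Cluster, (2.14) p.15 (bookkeeping)] -/
theorem Gam_eq (Z : (domSys P M (k + 1)).Dom) (t : TermLabel P M k L) (φ : CPair P 𝔸) (σ : TPt P.d (domCount P M (k + 1)) → ℂ)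
    (X : (𝔇.𝒦 Z t).Λ ⊕ (𝔇.𝒦 Z t).C₀ → ℝ) :
    𝔇.Gam Z t φ σ X = (𝔇.𝒦 Z t).G2 σ (𝔇.uOf Z t φ) *ᵥ fun j => (X j : ℂ) := rfl

end TermDatum214

section Lists

variable {P : Params} {M k L : ℕ} [NeZero L]

open Classical in
/-- The σ-list enumerates the cubes of `Z ∖ Z′₀` without repetition (the `hlZ` binder of the (2.26) engines).
[cite: Balaban1988RG2Cluster, (2.14) p.15 (bookkeeping)] -/
theorem sigmaList_spec (Z : (domSys P M (k + 1)).Dom) (t : TermLabel P M k L) :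
    (sigmaList L Z t).Nodup ∧
      (sigmaList L Z t).toFinset = (Z : TDom P.d (domCount P M (k + 1))).1 \ tclosure L (domCount P M (k + 1)) (Z0 M t) :=
  ⟨Finset.nodup_toList _, Finset.toList_toFinset _⟩

open Classical in
/-- The τ-list enumerates the domains of 𝐃 without repetition (the `hlD` binder of the (2.26) engines).
[cite: Balaban1988RG2Cluster, (2.14) p.15 (bookkeeping)] -/
theorem tauList_spec (t : TermLabel P M k L) : (tauList P M k L t).Nodup ∧ (tauList P M k L t).toFinset = t.1 :=
  ⟨Finset.nodup_toList _, Finset.toList_toFinset _⟩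

/-- The τ-list has `|𝐃|` entries. [cite: Balaban1988RG2Cluster, (2.14) p.15 (bookkeeping)] -/
theorem length_tauList (t : TermLabel P M k L) : (tauList P M k L t).length = t.1.card := Finset.length_toList _

open Classical in
/-- The σ-list has `#(Z ∖ Z′₀)` entries. [cite: Balaban1988RG2Cluster, (2.14) p.15 (bookkeeping)] -/
theorem length_sigmaList (Z : (domSys P M (k + 1)).Dom) (t : TermLabel P M k L) :
    (sigmaList L Z t).length = ((Z : TDom P.d (domCount P M (k + 1))).1 \ tclosure L (domCount P M (k + 1)) (Z0 M t)).card :=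
  Finset.length_toList _

end Lists

/-! ## §2  History enters through `𝐕_k` only; coupling and configuration congruences -/

namespace TermDatum214

variable {c : B13.Consts} {P : Params} {𝔸 : Type*} {M k L : ℕ} [NeZero L] (𝔇 : TermDatum214 c P 𝔸 M k L)

/-- Older terms giving the same potentials `𝐕_k(Y, ·)` give the same last line. [cite: Balaban1988RG2Cluster, (2.14) p.15 and (1.41) p.11] -/
theorem lastLine_congr_old (Z : (domSys P M (k + 1)).Dom) (t : TermLabel P M k L) (s : ℂ) {old old' : OlderTerms P 𝔸 M k} (φ : CPair P 𝔸)
    (h : ∀ Y B, 𝔇.𝒱 Z t s old φ Y B = 𝔇.𝒱 Z t s old' φ Y B) :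
    𝔇.lastLine Z t s old φ = 𝔇.lastLine Z t s old' φ := by
  have hV : 𝔇.𝒱 Z t s old φ = 𝔇.𝒱 Z t s old' φ := funext fun Y => funext (h Y)
  simp only [lastLine, hV]

/-- Older terms giving the same potentials give the same X-integral. [cite: Balaban1988RG2Cluster, (2.14) p.15 and (1.41) p.11] -/
theorem core_congr_old (Z : (domSys P M (k + 1)).Dom) (t : TermLabel P M k L) (s : ℂ) {old old' : OlderTerms P 𝔸 M k} (φ : CPair P 𝔸)
    (h : ∀ Y B, 𝔇.𝒱 Z t s old φ Y B = 𝔇.𝒱 Z t s old' φ Y B) :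
    𝔇.core Z t s old φ = 𝔇.core Z t s old' φ := by
  simp only [core, 𝔇.lastLine_congr_old Z t s φ h]

/-- **HISTORY ENTERS THROUGH `𝐕_k` ONLY**: older terms giving the same potentials `𝐕_k(Y, ·)` on the domains of the fine torus give the SAME (2.14)
term — print's dependence of the step-`k` term on `E^{(j)}`, `j ≤ k`, factors through Lemma 2's potentials (the atom of the per-term locality
(S-loc-T) of the Summit-side N22 modules: a locality law of `𝒱` in the older terms transfers verbatim to `TF`).
[cite: Balaban1988RG2Cluster, (2.14) p.15 and (1.41) p.11; Balaban1987RG1, (2.12)-(2.13) p.268] -/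
theorem TF_congr_old (Z : (domSys P M (k + 1)).Dom) (t : TermLabel P M k L) (s : ℂ) {old old' : OlderTerms P 𝔸 M k} (φ : CPair P 𝔸)
    (h : ∀ Y B, 𝔇.𝒱 Z t s old φ Y B = 𝔇.𝒱 Z t s old' φ Y B) :
    𝔇.TF Z t s old φ = 𝔇.TF Z t s old' φ := by
  simp only [TF, 𝔇.core_congr_old Z t s φ h]

/-- **LOCALITY OF THE POTENTIALS IN THE HISTORY ON A SPACE-TABLE FAMILY** (hypothesis schema — a LAW on the datum, NOT typed as holding: print's
`𝐕_k(Y, ·)` is assembled from the older terms restricted to the small-field spaces, [II] (1.33)–(1.41), which is Lemma 2's reading): older-terms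
families agreeing on the tables `sp j Y` give the same potentials, at every `Z`, term, coupling, configuration.  The `sp`-currency is the Summit-side
one (N18's `sp`, N22's `spaceI … (domSites …) α₀ α₁`). [cite: Balaban1988RG2Cluster, (1.41) p.11 and (2.14) p.15; Balaban1987RG1, (2.12)-(2.13) p.268] -/
def PotentialsLocalOn (sp : (j : ℕ) → (domSys P M j).Dom → Set (CPair P 𝔸)) : Prop :=
  ∀ (Z : (domSys P M (k + 1)).Dom) (t : TermLabel P M k L) (s : ℂ) (φ : CPair P 𝔸) (old old' : OlderTerms P 𝔸 M k),
    (∀ (j : Fin (k + 1)) (Y : (domSys P M j).Dom) (ψ : CPair P 𝔸), ψ ∈ sp j Y → old j Y ψ = old' j Y ψ) →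
      ∀ Y B, 𝔇.𝒱 Z t s old φ Y B = 𝔇.𝒱 Z t s old' φ Y B

/-- **(S-loc-T) AT THE DATUM FROM THE LOCALITY OF THE POTENTIALS**: under `PotentialsLocalOn sp`, older-terms families agreeing on the tables `sp` give
the same (2.14) term — verbatim the per-term locality hypothesis `hlocT` of the Summit-side N22 term-indexed modules at `TF := 𝔇.TF` (`TF_congr_old`).
[cite: Balaban1988RG2Cluster, (2.14) p.15 and (1.41) p.11; Balaban1987RG1, (2.12)-(2.13) p.268] -/
theorem TF_congr_old_of_potentialsLocalOn [NeZero M] {sp : (j : ℕ) → (domSys P M j).Dom → Set (CPair P 𝔸)} (hV : 𝔇.PotentialsLocalOn sp)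
    (s : ℂ) (old old' : OlderTerms P 𝔸 M k) (φ : CPair P 𝔸) (Z : (domSys P M (k + 1)).Dom)
    (h : ∀ (j : Fin (k + 1)) (Y : (domSys P M j).Dom) (ψ : CPair P 𝔸), ψ ∈ sp j Y → old j Y ψ = old' j Y ψ) :
    ∀ t ∈ terms L M Z, 𝔇.TF Z t s old φ = 𝔇.TF Z t s old' φ :=
  fun t _ => 𝔇.TF_congr_old Z t s φ (hV Z t s φ old old' h)

/-- The configuration enters the kernels through `uOf` only: configurations read alike give the same `A(σ)`. [cite: Balaban1988RG2Cluster, (2.14) p.15 (bookkeeping)] -/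
theorem A_congr (Z : (domSys P M (k + 1)).Dom) (t : TermLabel P M k L) {φ φ' : CPair P 𝔸} (hu : 𝔇.uOf Z t φ = 𝔇.uOf Z t φ') :
    𝔇.A Z t φ = 𝔇.A Z t φ' := by
  funext σ; simp only [A_apply, hu]

/-- Configurations read alike give the same `Γ(σ)`. [cite: Balaban1988RG2Cluster, (2.14) p.15 (bookkeeping)] -/
theorem Gam_congr (Z : (domSys P M (k + 1)).Dom) (t : TermLabel P M k L) {φ φ' : CPair P 𝔸} (hu : 𝔇.uOf Z t φ = 𝔇.uOf Z t φ') :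
    𝔇.Gam Z t φ = 𝔇.Gam Z t φ' := by
  funext σ X; simp only [Gam_eq, hu]

/-- **Joint congruence**: two (coupling, history, configuration) triples at which the kernels read the same configuration, the characteristic
functions are the same functions of the row-bond field, and the potentials agree, give the same (2.14) term — the term reads `(s, old, φ)` ONLY through
`uOf φ`, `χ(s, ·)`, `χᶜ(s, ·)` and `𝒱 s old φ`. [cite: Balaban1988RG2Cluster, (2.14) p.15, (2.3) p.12 and (1.41) p.11] -/
theorem TF_congr (Z : (domSys P M (k + 1)).Dom) (t : TermLabel P M k L) {s s' : ℂ} {old old' : OlderTerms P 𝔸 M k} {φ φ' : CPair P 𝔸}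
    (hu : 𝔇.uOf Z t φ = 𝔇.uOf Z t φ') (hχ : 𝔇.chiY₀ Z t s = 𝔇.chiY₀ Z t s') (hχc : 𝔇.chicP Z t s = 𝔇.chicP Z t s')
    (hV : ∀ Y B, 𝔇.𝒱 Z t s old φ Y B = 𝔇.𝒱 Z t s' old' φ' Y B) :
    𝔇.TF Z t s old φ = 𝔇.TF Z t s' old' φ' := by
  have hV' : 𝔇.𝒱 Z t s old φ = 𝔇.𝒱 Z t s' old' φ' := funext fun Y => funext (hV Y)
  simp only [TF, core, lastLine, 𝔇.A_congr Z t hu, 𝔇.Gam_congr Z t hu, hχ, hχc, hV']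

end TermDatum214

/-! ## §3  The generator tower of a term-datum family: activities and the recursion (2.13) with the (2.14) terms -/

namespace TermData214

variable {c : B13.Consts} {P : Params} {𝔸 : Type*} {M L : ℕ} [NeZero L] (𝔇 : TermData214 c P 𝔸 M L)

/-- The term-functional family of a term-datum family (step-wise `TermDatum214.TF`). [cite: Balaban1988RG2Cluster, (2.14) p.15; Balaban1987RG1, (2.12)-(2.13) p.268] -/
def TF : GenTermFun P 𝔸 M L := fun k => (𝔇 k).TF

/-- Face: `𝔇.TF k = (𝔇 k).TF` (`rfl`). [cite: Balaban1988RG2Cluster, (2.14) p.15 (bookkeeping)] -/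
@[simp] theorem TF_apply (k : ℕ) : 𝔇.TF k = (𝔇 k).TF := rfl

variable [NeZero M]

/-- **THE GENERATOR TOWER OF A TERM-DATUM FAMILY**: g6's term-indexed generator tower at the generated term functionals — indices at `Z` = the pairs
`(Z, t)`, `t ∈ terms L M Z`, generic term = (2.14) of the datum. [cite: Balaban1988RG2Cluster, (2.9)-(2.11) p.14 and (2.14) p.15; Balaban1987RG1, (2.12)-(2.13) p.268] -/
def Gn : GenTower P 𝔸 M := GenTower.ofTerms L 𝔇.TF

/-- Face: `𝔇.Gn = GenTower.ofTerms L 𝔇.TF` (`rfl`; the N18 ∕ N22 term-indexed modules instantiate at `TF := 𝔇.TF`). [cite: Balaban1988RG2Cluster, (2.14) p.15 (bookkeeping)] -/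
theorem Gn_eq : 𝔇.Gn = GenTower.ofTerms L 𝔇.TF := rfl

/-- Face: the step-`k` generator of the tower (`rfl`). [cite: Balaban1988RG2Cluster, (2.14) p.15 (bookkeeping)] -/
@[simp] theorem Gn_apply (k : ℕ) : 𝔇.Gn (L := L) k = StepGen.ofTerms L (𝔇 k).TF := rfl

open Classical in
/-- **THE ACTIVITY (2.11) OF THE DATUM's GENERATOR**: `H(Z) = Σ_{(𝐃,P) ∈ terms L M Z} term214 r (Z∖Z′₀) 𝐃 Ψ_{(𝐃,P)} 0 0` — print's (2.9)∕(2.11) with the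
(2.14) terms, at (coupling, history, configuration). [cite: Balaban1988RG2Cluster, (2.9)-(2.11) p.14 and (2.14) p.15] -/
theorem H_Gn (k : ℕ) (s : ℂ) (old : OlderTerms P 𝔸 M k) (φ : CPair P 𝔸) (Z : (domSys P M (k + 1)).Dom) :
    (𝔇.Gn (L := L) k).H s old φ Z =
      ∑ t ∈ terms L M Z, term214 (𝔇 k).r (sigmaList L Z t) (tauList P M k L t) ((𝔇 k).core Z t s old φ) 0 0 := by
  rw [Gn_apply, ofTerms_H]; rfl

/-- The activity of the datum's generator is dominated by the sum of the norms of its (2.14) terms (the domination clause of the Summit-side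
(S-226)∕(GEN) schemas, `norm_H_ofTerms_le` by name). [cite: Balaban1988RG2Cluster, (2.9)-(2.11) p.14 and (2.26) p.17] -/
theorem norm_H_Gn_le (k : ℕ) (s : ℂ) (old : OlderTerms P 𝔸 M k) (φ : CPair P 𝔸) (Z : (domSys P M (k + 1)).Dom) :
    ‖(𝔇.Gn (L := L) k).H s old φ Z‖ ≤ ∑ t ∈ terms L M Z, ‖(𝔇 k).TF Z t s old φ‖ := by
  rw [Gn_apply]; exact norm_H_ofTerms_le L (𝔇 k).TF s old φ Z

/-- **THE W1 RECURSION (2.13) WITH THE (2.14) TERMS OF THE DATUM**: at a (complex) coupling history `g`,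
`E^{(k+1)}(X; g) = locE (Z ↦ Σ_{(𝐃,P) ∈ terms} (2.14)_{(𝐃,P)}(Z)(g_k, (E^{(j)}(g))_{j≤k}, φ)) X` — the older terms entering each (2.14) term through the
potentials `𝐕_k` (`recTerm_ofTerms_succ` by name). [cite: Balaban1987RG1, (2.12)-(2.13) p.268; Balaban1988RG2Cluster, (2.13)-(2.14) pp.14-15] -/
theorem recTerm_Gn_succ (g : ℕ → ℂ) (k : ℕ) (X : (domSys P M (k + 1)).Dom) (φ : CPair P 𝔸) :
    recTerm (𝔇.Gn (L := L)) g (k + 1) X φ =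
      (StepGen.ofTerms L (𝔇 k).TF).E (g k) (olderOf (recTerm (𝔇.Gn (L := L)) g) k) φ X :=
  recTerm_succ _ g k X φ

open Classical in
/-- The same with print's term sum spelled out: `E^{(k+1)}(X; g) = locE (Z ↦ Σ_{t ∈ terms L M Z} (𝔇 k).TF Z t g_k (E^{(j)}(g))_{j≤k} φ) X`
(`recTerm_ofTerms_succ` by name). [cite: Balaban1987RG1, (2.12)-(2.13) p.268; Balaban1988RG2Cluster, (2.13)-(2.14) pp.14-15] -/
theorem recTerm_Gn_succ_sum (g : ℕ → ℂ) (k : ℕ) (X : (domSys P M (k + 1)).Dom) (φ : CPair P 𝔸) :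
    recTerm (𝔇.Gn (L := L)) g (k + 1) X φ =
      B13Resummation.locE (tgeometry P.d (domCount P M (k + 1))).ι (tgeometry P.d (domCount P M (k + 1))).cubes
        (fun Z => ∑ t ∈ terms L M Z, (𝔇 k).TF Z t (g k) (olderOf (recTerm (𝔇.Gn (L := L)) g) k) φ) (Subtype.val X) :=
  recTerm_ofTerms_succ L 𝔇.TF g k X φ

end TermData214

/-! ## §4  The (2.26) socket at the datum, kernel-keyed (`h226_torus_of_primitives` by name) -/

namespace TermDatum214

variable {c : B13.Consts} {P : Params} {𝔸 : Type*} {M k L : ℕ} [NeZero L] (𝔇 : TermDatum214 c P 𝔸 M k L)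

open Classical in
/-- **(2.26) FOR THE DATUM's TERM FROM THE LOCATED PRIMITIVE INPUTS, KERNEL-KEYED** — `B13Lemma3TorusPrimitive.h226_torus_of_primitives` for the term
`𝔇.TF Z t s old φ` = `term214 r (Z∖Z′₀) 𝐃 (core214 A Γ (F214 |P| χ χᶜ 𝐃 𝒱)) 0 0`, with the Γ-kernel `G(σ) := (𝒦 Z t).G2 σ (uOf φ)`, the references
`Γ₀ := (𝒦 Z t).Γ₀`, `C := (𝒦 Z t).C ≻ 0`, the locations and the row fibre bound READ OFF NODE A's kernel record, and the list ∕ linearity binders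
discharged (`sigmaList_spec`, `tauList_spec`, `rfl`).  What is left = the located inputs: the τ-radii conditions of (2.18), the analyticity domains,
separate analyticity of the X-integral, symmetry ∕ `Re ≻ 0` of `A(σ,u)`, the (2.22) shape of `χχᶜ` and the (2.20) shape of `𝒱`, the column fibre
bound, (L17a)∕(L16a) for the kernels at the configuration (NODE A: `localisation17a_of_termWalkData`, `differences216_of_termWalkData`), and the
numerics of (2.24)–(2.26).  One application of the tree theorem; no estimate proved here.
[cite: Balaban1988RG2Cluster, (2.14)-(2.15) p.15, (2.16)-(2.22) p.16, (2.23)-(2.26) p.17] -/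
theorem norm_TF_le_weight_of_primitives (hκ₁ : 1 ≤ c.κ₁) (hα₆ : c.α₆ ≠ 0)
    (Z : (domSys P M (k + 1)).Dom) (t : TermLabel P M k L) (s : ℂ) (old : OlderTerms P 𝔸 M k) (φ : CPair P 𝔸)
    (hpos : ∀ Y : TDom P.d (L * domCount P M (k + 1)), 0 < invTau c ((tsys P.d (L * domCount P M (k + 1))).dj Y))
    (hhalf : ∀ Y : TDom P.d (L * domCount P M (k + 1)), invTau c ((tsys P.d (L * domCount P M (k + 1))).dj Y) ≤ 1 / 2)
    {Uσ Uτ : Set ℂ} (hUσ : IsOpen Uσ) (hUτ : IsOpen Uτ) (hUexp : closedBall (0 : ℂ) (Real.exp c.κ₁) ⊆ Uσ)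
    (hUtau : ∀ Y : TDom P.d (L * domCount P M (k + 1)), closedBall (0 : ℂ) ((invTau c ((tsys P.d (L * domCount P M (k + 1))).dj Y))⁻¹) ⊆ Uτ)
    (hr : 0 < 𝔇.r) (hr' : 𝔇.r ≤ Real.exp c.κ₁ - 1)
    (hsubτ : ∀ x ∈ Set.uIcc (0 : ℝ) 1, closedBall (x : ℂ) 𝔇.r ⊆ Uτ)
    -- the last line at the coupling: signs of χ, χᶜ
    (hχ0 : ∀ B, 0 ≤ 𝔇.chiY₀ Z t s B) (hχc0 : ∀ B, 0 ≤ 𝔇.chicP Z t s B)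
    -- separate analyticity of the X-integral
    (hΨσ : ∀ τ : TDom P.d (L * domCount P M (k + 1)) → ℂ, (∀ j, τ j ∈ Uτ) → SepHolOn Uσ (fun σ => 𝔇.core Z t s old φ σ τ))
    (hΨτ : ∀ σ : TPt P.d (domCount P M (k + 1)) → ℂ, (∀ j, σ j ∈ Uσ) → SepHolOn Uτ (fun τ => 𝔇.core Z t s old φ σ τ))
    -- NODE A: symmetry and `Re ≻ 0` of the precision at (σ, u)
    (hAs : ∀ σ : TPt P.d (domCount P M (k + 1)) → ℂ, (∀ j, ‖σ j‖ ≤ Real.exp c.κ₁) → (𝔇.A Z t φ σ).IsSymm)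
    (hA : ∀ σ : TPt P.d (domCount P M (k + 1)) → ℂ, (∀ j, ‖σ j‖ ≤ Real.exp c.κ₁) → ((𝔇.A Z t φ σ).map Complex.re).PosDef)
    -- the (2.22) and (2.20) shapes
    {γ₂ rP a₂₀ w : ℝ} (qP : ((𝔇.𝒦 Z t).Λ → ℝ) → ℝ)
    (h222 : ∀ B, 𝔇.chiY₀ Z t s B * 𝔇.chicP Z t s B ≤ Real.exp (-(γ₂ / 2 * rP ^ 2 * (t.2.card : ℕ)) + γ₂ / 2 * qP B)) (hγ₂ : 0 ≤ γ₂)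
    (hqP : ∀ B, qP B ≤ B ⬝ᵥ B)
    (h220R : ∀ B, ∑ Y ∈ t.1, (invTau c ((tsys P.d (L * domCount P M (k + 1))).dj Y))⁻¹ * ‖𝔇.𝒱 Z t s old φ Y B‖ ≤ a₂₀ / 2 * (B ⬝ᵥ B) + w)
    (ha0 : 0 ≤ a₂₀)
    -- the column fibre bound (rows: the kernel record's `hfib`)
    (hfibN : ∀ x : UT 𝔇.Nf, (Finset.univ.filter fun j => (𝔇.𝒦 Z t).locN j = x).card ≤ (𝔇.𝒦 Z t).m)
    -- rates and constants
    {kap kap' kap'' θ θE θΓ θC KG KΓ KCs K₀ : ℝ} (hkap'' : 0 < kap'') (h1 : kap'' < kap') (h2 : kap' < kap)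
    (hθE : 0 ≤ θE) (hθΓ : 0 ≤ θΓ) (hθC : 0 ≤ θC) (hKG : 0 ≤ KG) (hKΓ : 0 ≤ KΓ) (hKCs : 0 ≤ KCs) (hK₀ : 0 ≤ K₀)
    (hθEle : θE ≤ θ) (hθΓle : θΓ ≤ θ)
    (hθR1le : ((𝔇.𝒦 Z t).m * (1 + 2 / (kap - kap')) ^ 𝔇.ν) * ((𝔇.𝒦 Z t).m * (1 + 2 / (kap' - kap'')) ^ 𝔇.ν)
      * (θΓ * KCs * KG + KΓ * θC * KG + KΓ * K₀ * θΓ) ≤ θ)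
    -- (L17a) for the kernels at the configuration, in the torus distance
    (hG : ∀ σ : TPt P.d (domCount P M (k + 1)) → ℂ, (∀ j, ‖σ j‖ ≤ Real.exp c.κ₁) →
      ∀ b j, ‖(𝔇.𝒦 Z t).G2 σ (𝔇.uOf Z t φ) b j‖ ≤ KG * Real.exp (-(kap * tdist1 𝔇.Nf ((𝔇.𝒦 Z t).locΛ b) ((𝔇.𝒦 Z t).locN j))))
    (hΓ₀ : ∀ b j, ‖(𝔇.𝒦 Z t).Γ₀ b j‖ ≤ KΓ * Real.exp (-(kap * tdist1 𝔇.Nf ((𝔇.𝒦 Z t).locΛ b) ((𝔇.𝒦 Z t).locN j))))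
    (hCs : ∀ σ : TPt P.d (domCount P M (k + 1)) → ℂ, (∀ j, ‖σ j‖ ≤ Real.exp c.κ₁) →
      ∀ b b', ‖(𝔇.A Z t φ σ)⁻¹ b b'‖ ≤ KCs * Real.exp (-(kap * tdist1 𝔇.Nf ((𝔇.𝒦 Z t).locΛ b) ((𝔇.𝒦 Z t).locΛ b'))))
    (hC216 : ∀ b b', ‖(𝔇.𝒦 Z t).C b b'‖ ≤ K₀ * Real.exp (-(kap * tdist1 𝔇.Nf ((𝔇.𝒦 Z t).locΛ b) ((𝔇.𝒦 Z t).locΛ b'))))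
    -- (L16a) for the kernels at the configuration, in the torus distance
    (hdΓ : ∀ σ : TPt P.d (domCount P M (k + 1)) → ℂ, (∀ j, ‖σ j‖ ≤ Real.exp c.κ₁) →
      ∀ b j, ‖((𝔇.𝒦 Z t).G2 σ (𝔇.uOf Z t φ) - (𝔇.𝒦 Z t).Γ₀.map (algebraMap ℝ ℂ)) b j‖
        ≤ θΓ * Real.exp (-(kap * tdist1 𝔇.Nf ((𝔇.𝒦 Z t).locΛ b) ((𝔇.𝒦 Z t).locN j))))
    (hdC : ∀ σ : TPt P.d (domCount P M (k + 1)) → ℂ, (∀ j, ‖σ j‖ ≤ Real.exp c.κ₁) →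
      ∀ b b', ‖((𝔇.A Z t φ σ)⁻¹ - (𝔇.𝒦 Z t).C.map (algebraMap ℝ ℂ)) b b'‖
        ≤ θC * Real.exp (-(kap * tdist1 𝔇.Nf ((𝔇.𝒦 Z t).locΛ b) ((𝔇.𝒦 Z t).locΛ b'))))
    (hdE : ∀ σ : TPt P.d (domCount P M (k + 1)) → ℂ, (∀ j, ‖σ j‖ ≤ Real.exp c.κ₁) →
      ∀ b b', ‖(𝔇.A Z t φ σ - (𝔇.𝒦 Z t).C⁻¹.map (algebraMap ℝ ℂ)) b b'‖
        ≤ θE * Real.exp (-(kap * tdist1 𝔇.Nf ((𝔇.𝒦 Z t).locΛ b) ((𝔇.𝒦 Z t).locΛ b'))))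
    (hsmallKθ : K₀ * ((𝔇.𝒦 Z t).m * (1 + 2 / kap) ^ 𝔇.ν) * (θ * ((𝔇.𝒦 Z t).m * (1 + 2 / kap'') ^ 𝔇.ν)) < 1)
    -- the (2.24)–(2.25) smallness
    {cE g : ℝ} (hc0 : 0 ≤ cE) (hc : ∀ i, (𝔇.𝒦 Z t).hC.1.eigenvalues i ≤ cE)
    (hαc : (2 * (θ * ((𝔇.𝒦 Z t).m * (1 + 2 / kap'') ^ 𝔇.ν)) + (γ₂ + a₂₀)) * cE ≤ 1 / 2) (hg : 0 ≤ g)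
    (hΓq : ∀ X : (𝔇.𝒦 Z t).Λ ⊕ (𝔇.𝒦 Z t).C₀ → ℝ,
      ((𝔇.𝒦 Z t).Γ₀ *ᵥ X) ⬝ᵥ ((𝔇.𝒦 Z t).C *ᵥ ((𝔇.𝒦 Z t).Γ₀ *ᵥ X)) ≤ g * (X ⬝ᵥ X))
    (hsmall : (2 * (θ * ((𝔇.𝒦 Z t).m * (1 + 2 / kap'') ^ 𝔇.ν)) + (γ₂ + a₂₀)) * (1 + 2 * cE * g) ≤ 1 / 2)
    -- constant matching, p. 17
    {a a₅ : ℝ} (hPa : a ≤ γ₂ * rP ^ 2)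
    (hvol : 2 * (K₀ * ((𝔇.𝒦 Z t).m * (1 + 2 / kap) ^ 𝔇.ν) * (θ * ((𝔇.𝒦 Z t).m * (1 + 2 / kap'') ^ 𝔇.ν))
              * (1 + (1 - K₀ * ((𝔇.𝒦 Z t).m * (1 + 2 / kap) ^ 𝔇.ν) * (θ * ((𝔇.𝒦 Z t).m * (1 + 2 / kap'') ^ 𝔇.ν)))⁻¹) / 2)
          * (Fintype.card (𝔇.𝒦 Z t).Λ : ℝ)
        + w + (2 * (θ * ((𝔇.𝒦 Z t).m * (1 + 2 / kap'') ^ 𝔇.ν)) + (γ₂ + a₂₀)) * cE * (Fintype.card (𝔇.𝒦 Z t).Λ : ℝ)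
        + (2 * (θ * ((𝔇.𝒦 Z t).m * (1 + 2 / kap'') ^ 𝔇.ν)) + (γ₂ + a₂₀)) * (1 + 2 * cE * g)
          * (Fintype.card ((𝔇.𝒦 Z t).Λ ⊕ (𝔇.𝒦 Z t).C₀) : ℝ)
        ≤ a₅ * ((Z.1).card : ℝ)) :
    ‖𝔇.TF Z t s old φ‖ ≤ weight L M c Z a t * Real.exp (a₅ * ((Z.1).card : ℝ)) :=
  h226_torus_of_primitives c hκ₁ hα₆ Z t hpos hhalf hUσ hUτ hUexp hUtau hr hr' hsubτ
    (sigmaList L Z t) (sigmaList_spec Z t) (tauList P M k L t) (tauList_spec t)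
    (𝔇.A Z t φ) (𝔇.Gam Z t φ) (𝔇.chiY₀ Z t s) (𝔇.chicP Z t s) hχ0 hχc0 t.1 (𝔇.𝒱 Z t s old φ) hΨσ hΨτ
    (𝔇.𝒦 Z t).hC (𝔇.𝒦 Z t).Γ₀ hAs hA (fun σ => (𝔇.𝒦 Z t).G2 σ (𝔇.uOf Z t φ)) (fun _ _ _ => rfl)
    qP h222 hγ₂ hqP h220R ha0 (𝔇.𝒦 Z t).locΛ (𝔇.𝒦 Z t).locN (𝔇.𝒦 Z t).hfib hfibN
    hkap'' h1 h2 hθE hθΓ hθC hKG hKΓ hKCs hK₀ hθEle hθΓle hθR1le hG hΓ₀ hCs hC216 hdΓ hdC hdE hsmallKθ hc0 hc hαc hg hΓq hsmall hPa hvol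

end TermDatum214

/-! ## §5  Honesty: term data exist (the datum Type is inhabited) -/

section Honesty

variable (c : B13.Consts) (P : Params) (𝔸 : Type*) (M k L : ℕ) [NeZero L]

/-- **TERM DATA EXIST** (non-vacuity of §1's Type, degenerate data — nothing of print's): NODE A's FREE kernels `B13TermWalkDataOneTorus.freeKernels` on ONE
row bond (`Λ := Unit`, no extra columns, the zero-dimensional site torus), zero configuration reading, Cauchy radius `1`, zero characteristic functions
and zero potentials. [cite: Balaban1988RG2Cluster, (2.14) p.15 and (2.3) p.12 (degenerate data; bookkeeping)] -/
theorem nonempty_termDatum214 : Nonempty (TermDatum214 c P 𝔸 M k L) := by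
  classical
  haveI : ∀ i : Fin 0, NeZero ((![] : Fin 0 → ℕ) i) := fun i => i.elim0
  let z : UT (![] : Fin 0 → ℕ) := UT.ofSite (N := (![] : Fin 0 → ℕ)) fun i => i.elim0
  exact ⟨{ ν := 0, Nf := ![], E₃ := ℂ,
           𝒦 := fun _ _ => freeKernels c ℂ Unit Empty (fun _ => z) (fun _ => z),
           finC₀ := fun _ _ => inferInstanceAs (Fintype Empty),
           decC₀ := fun _ _ => inferInstanceAs (DecidableEq Empty),
           uOf := fun _ _ _ => 0, r := 1,
           chiY₀ := fun _ _ _ _ => 0, chicP := fun _ _ _ _ => 0,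
           𝒱 := fun _ _ _ _ _ _ _ => 0 }⟩

/-- **TERM-DATUM FAMILIES EXIST** (one degenerate datum per step). [cite: Balaban1988RG2Cluster, (2.14) p.15 (bookkeeping)] -/
theorem nonempty_termData214 : Nonempty (TermData214 c P 𝔸 M L) :=
  ⟨fun k => Classical.choice (nonempty_termDatum214 c P 𝔸 M k L)⟩

end Honesty

end W1

end Literature.MathematicalPhysics.QuantumFieldTheory.Balaban1983to89.Node00

end
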